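import Summits.QuantumFields.YangMills.Theorems.UnitScaleTiltProp8ChartHInvBridge
import HarnessLib

/-!
# Route `UnitScaleTilt`, crux K1 «MinimiserStabilityRegPr» (stmt-QuantumFields-19200), leaf V2′ — the P2→P3 BRIDGE (hH of `ChartRemainderAt`),
# part C2: **THE WEIGHTED SUP LETTER OF `H X = H₀X̃′ + dφ` AND THE PACKAGED BRIDGE `exists_rightInverse` — k-UNIFORM**

Cell `ym3-torus`, seat `ym3-torus-p1` g18.  THE CONSTRUCTION (nested family `D`, (2.2)-admissible with `2L ≤ R·M + 1`; `H₀` any real right inverse of the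
multi-level straight average `X ↦ (Q_jH₀X)(c) = X(j,c)` on the index bonds `𝔅 = ⋃_j Λ_j`, e.g. P2's flat `H = GQ*(QGQ*)⁻¹` (157)):
* corrected data `X̃′(j,c) = (L^jη)⁻¹·(X(j,c) + κ_j(c₊) − κ_j(c₋))`, `κ_j(y) = 0` if `y ∈ Ω_j^{(j)}`, else (a STRADDLING end-point, `j = i+1`) `κ_j(y) = λ̄_{X_i}(y)`,
  the comb mean over `B(y)` of the level-`i` DATA read as a field on the `i`-bonds (`Xf`); a functional of the data alone;
* `Y = H₀ᴹX̃′` (the real kernel of `H₀` against the matrix data), so `Q_jY = X̃′` on `𝔅`;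
* `φ(x) = Σ_{(j,y) ∈ 𝔅′} τ_{(j,y)}(x)·Λ_j(Y)(y)` — the hierarchical comb functional of part A at the SITE indices `𝔅′ = ⋃_j Λ_j` (sites), spread by the tents of
  part B; `H X = Y + dφ`.
THE IDENTITY `η·Q^{(j)}(HX)(c) = X(j,c)` on `𝔅` (`main_identity`): `Q^{(j)} = L^jQ_j − dΛ_j` and `Q^{(j)}(dφ) = d(φ∘embIter j)` (part A); at an end-point
`y ∈ Λ_j` (sites) the tent sum pins `φ(embIter j y) = Λ_j(Y)(y)` (`phi_pin`), cancelling the comb; at a straddling end-point `u ∉ Ω_j^{(j)}` (`j = i+1`; by the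
collar all `i`-blocks of `B(u)` lie in `Λ_i`, so `emb u` is pinned at level `i` and every staircase bond of `B(u)` is a NON-straddling index bond of level `i`)
the recursion `Λ_{i+1}(Y)(u) = L^i·λ̄_{Q_iY}(u) + Λ_i(Y)(emb u)` leaves `L^i·λ̄_{Q_iY}(u) = η⁻¹·λ̄_{X_i}(u)` — a functional of the DATA, which the correction `κ`
removes exactly (`straddle_defect`).  THE LETTER (`letter`): `w₁(b)·‖HX(b)‖ ≤ B₀(1+2C)(1+2C+2CL)·t` for `‖X‖_∞ ≤ t`, `C = (d+2)L`, from `H₀`'s weighted letter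
(P2's (46): `w₁(b)·|H₀X(b)| ≤ B₀·sup_c L^{j(c)}η|X(c)|`), the local size `‖Λ_j(Y)(y)‖ ≤ C·L^j·sup_{B^j(y)}‖Y‖`, the tents' slope `2/L^j`, and the territory collar
(the levels of the two end-points of a fine bond differ by `≤ 1`).  Packaged: `exists_rightInverse` (a ℂ-linear `H` with `η·Q^{(j)}(HX) = X` on `𝔅` and the
letter).  Theorems only; nothing of Bałaban's asserted.  NOT a claim about the mass gap.

References: T. Bałaban, CMP **102** (1985) 277–309 [Balaban1985Variational] ((45)–(46) p.285, (156)–(157) p.302, (161) p.303); CMP **98** (1985) 17–51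
[Balaban1985Averaging] ((62) p.28, (124)–(125) p.36); CMP **96** (1984) 223–250 [Balaban1984PropagatorsII] ((2.1)–(2.4) p.224, (2.20) p.226).
-/

noncomputable section

open scoped BigOperators Matrix.Norms.L2Operator

namespace Summit.QuantumFields.YangMills.Theorems.ChartHInv

open Literature.MathematicalPhysics.QuantumFieldTheory.Balaban1983to89
open T4Continuum BlockAveraging BlockAveragingEMLLinearised LatticeFieldCalculus
open B5Eq118OneStroke (iterBlockOf iterBlockOf_zero iterBlockOf_succ)
open B15DeterminingSets (embIter)
open B6SectADomainsV1 (Domains)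
open B6SectAOperatorsV1 (BondIdx SiteIdx)
open B11Eq115Space (levOf)
open Summit.QuantumFields.YangMills.Theorems.FlatCubeOpsText (Adm22)
open Summit.QuantumFields.YangMills.Theorems.Prop8Chart (collar_of_adm22)
open Summit.QuantumFields.YangMills.Theorems.Prop7CombGauge (combMean_add)
open Literature.MathematicalPhysics.QuantumFieldTheory.BalabanImbrieJaffe1984to88.BIJ88RT51Background (iterBlockOf_embIter)

variable {P : Params} {n : Type*}

section Construction

variable (D : Domains P) (η : ℝ)
  (Q : (i : ℕ) → (PBond P 0 → Matrix n n ℂ) → PBond P i → Matrix n n ℂ)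
  (hQ0 : ∀ Y, Q 0 Y = Y) (hQs : ∀ (i : ℕ) (Y : PBond P 0 → Matrix n n ℂ) (c : PBond P (i + 1)), Q (i + 1) Y c = linAvg (Q i Y) c)
  (Λ : (i : ℕ) → (PBond P 0 → Matrix n n ℂ) → Site P i → Matrix n n ℂ)
  (hΛ0 : ∀ Y y, Λ 0 Y y = 0)
  (hΛs : ∀ (i : ℕ) (Y : PBond P 0 → Matrix n n ℂ) (y : Site P (i + 1)), Λ (i + 1) Y y = (P.L ^ i : ℕ) • combMean (bondAvgIter i Y) y + Λ i Y (emb y))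
  -- the data as level fields, the end-point correction, the corrected data
  (Xf : (BondIdx D → Matrix n n ℂ) → (i : ℕ) → PBond P i → Matrix n n ℂ)
  (hXf : ∀ X i b, Xf X i b = if h : D.LamBond i b then X ⟨⟨⟨i, Nat.lt_succ_of_le (D.le_of_lamBond h)⟩, b⟩, h⟩ else 0)
  (κ : (BondIdx D → Matrix n n ℂ) → (j : ℕ) → Site P j → Matrix n n ℂ)
  (hκ0 : ∀ X y, κ X 0 y = 0)
  (hκs : ∀ X (i : ℕ) (y : Site P (i + 1)), κ X (i + 1) y = if y ∈ D.Om (i + 1) then 0 else combMean (Xf X i) y)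
  (Xt : (BondIdx D → Matrix n n ℂ) → BondIdx D → Matrix n n ℂ)
  (hXt : ∀ X idx, Xt X idx = (((P.L : ℝ) ^ (idx.1.1 : ℕ) * η)⁻¹) • (X idx + (κ X idx.1.1 idx.1.2.tgt - κ X idx.1.1 idx.1.2.src)))
  -- the straight right inverse and its matrix extension
  (H₀ : (BondIdx D → ℝ) →ₗ[ℝ] (PBond P 0 → ℝ)) (hinv : ∀ (X : BondIdx D → ℝ) (i : BondIdx D), bondAvgIter (i.1.1 : ℕ) (H₀ X) i.1.2 = X i)
  (Y : (BondIdx D → Matrix n n ℂ) → PBond P 0 → Matrix n n ℂ)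
  (hY : ∀ X b, Y X b = ∑ i : BondIdx D, H₀ (Pi.single i 1) b • Xt X i)
  -- the tents and the gauge function
  (τ : SiteIdx D → Site P 0 → ℝ)
  (hτ1 : ∀ s, τ s (embIter (s.1.1 : ℕ) s.1.2) = 1) (hτ0 : ∀ s x, iterBlockOf (s.1.1 : ℕ) x ≠ s.1.2 → τ s x = 0)
  (φ : (BondIdx D → Matrix n n ℂ) → Site P 0 → Matrix n n ℂ)
  (hφ : ∀ X x, φ X x = ∑ s : SiteIdx D, τ s x • Λ (s.1.1 : ℕ) (Y X) s.1.2)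

/-! ## §5 The weighted sup letter -/

section Letter

variable [Fintype n] [DecidableEq n]
  (w₁ : PBond P 0 → ℝ) (hw₁ : ∀ b, w₁ b = (P.L : ℝ) ^ levOf (fun i => {z : Site P 0 | D.InOm i z}) D.k b.src * η)
  {B₀ : ℝ}
  (hsup : ∀ (Xr : BondIdx D → ℝ) (t : ℝ), 0 ≤ t → (∀ i, ((P.L : ℝ) ^ (i.1.1 : ℕ) * η) * |Xr i| ≤ t) → ∀ b, w₁ b * |H₀ Xr b| ≤ B₀ * t)
  (hτlip : ∀ (s : SiteIdx D) (b : PBond P 0), |τ s b.tgt - τ s b.src| ≤ 2 / (P.L : ℝ) ^ (s.1.1 : ℕ))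

include hXf in
/-- The data read as level fields is bounded by the data. [cite: Balaban1984PropagatorsII, (2.20) p.226] -/
theorem norm_Xf_le (X : BondIdx D → Matrix n n ℂ) {t : ℝ} (ht : 0 ≤ t) (hX : ∀ i, ‖X i‖ ≤ t) (i : ℕ) (b : PBond P i) : ‖Xf X i b‖ ≤ t := by
  rw [hXf]
  split_ifs
  · exact hX _
  · rw [norm_zero]; exact ht

include hXf hκ0 hκs in
/-- The end-point correction is bounded by `(d+2)L·t`. [cite: Balaban1985Averaging, (62) p.28] -/
theorem norm_kappa_le (X : BondIdx D → Matrix n n ℂ) {t : ℝ} (ht : 0 ≤ t) (hX : ∀ i, ‖X i‖ ≤ t) {j : ℕ} (hj : j ≤ P.m + P.K) (y : Site P j) :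
    ‖κ X j y‖ ≤ ((P.d + 2) * P.L : ℕ) * t := by
  cases j with
  | zero => rw [hκ0, norm_zero]; positivity
  | succ i =>
    rw [hκs]
    split_ifs
    · rw [norm_zero]; positivity
    · exact norm_combMean_le_of_local hj (Xf X i) y ht fun b _ _ => norm_Xf_le D Xf hXf X ht hX i b

include hXf hκ0 hκs hXt in
/-- The corrected data: `‖X̃′(j,c)‖ ≤ (L^jη)⁻¹·(1 + 2(d+2)L)·t`. [cite: Balaban1985Variational, (156) p.302] -/
theorem norm_Xt_le (hη : 0 < η) (X : BondIdx D → Matrix n n ℂ) {t : ℝ} (ht : 0 ≤ t) (hX : ∀ i, ‖X i‖ ≤ t) (idx : BondIdx D) :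
    ‖Xt X idx‖ ≤ (((P.L : ℝ) ^ (idx.1.1 : ℕ) * η)⁻¹) * ((1 + 2 * ((P.d + 2) * P.L : ℕ)) * t) := by
  have hj : (idx.1.1 : ℕ) ≤ P.m + P.K := (D.le_of_lamBond idx.2).trans D.hk
  have hpos : 0 < ((P.L : ℝ) ^ (idx.1.1 : ℕ) * η)⁻¹ := by have := P.L_pos; positivity
  rw [hXt, norm_smul, Real.norm_eq_abs, abs_of_pos hpos]
  refine mul_le_mul_of_nonneg_left ?_ hpos.le
  have h1 := norm_kappa_le D Xf hXf κ hκ0 hκs X ht hX hj idx.1.2.tgt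
  have h2 := norm_kappa_le D Xf hXf κ hκ0 hκs X ht hX hj idx.1.2.src
  calc ‖X idx + (κ X _ idx.1.2.tgt - κ X _ idx.1.2.src)‖ ≤ ‖X idx‖ + (‖κ X _ idx.1.2.tgt‖ + ‖κ X _ idx.1.2.src‖) :=
        (norm_add_le _ _).trans (add_le_add le_rfl (norm_sub_le _ _))
    _ ≤ t + (((P.d + 2) * P.L : ℕ) * t + ((P.d + 2) * P.L : ℕ) * t) := add_le_add (hX idx) (add_le_add h1 h2)
    _ = (1 + 2 * ((P.d + 2) * P.L : ℕ)) * t := by ring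

include hXf hκ0 hκs hXt hY hw₁ hsup in
/-- **THE LETTER OF `Y = H₀ᴹX̃′`**: `w₁(b)·‖Y(b)‖ ≤ B₀(1 + 2(d+2)L)·t` — the real kernel of `H₀` is absolutely bounded by `H₀`'s weighted letter tested on sign
data of weighted size `(L^jη)⁻¹`. [cite: Balaban1985Variational, (46) p.285] -/
theorem letter_Y (hη : 0 < η) (X : BondIdx D → Matrix n n ℂ) {t : ℝ} (ht : 0 ≤ t) (hX : ∀ i, ‖X i‖ ≤ t) (b : PBond P 0) :
    w₁ b * ‖Y X b‖ ≤ B₀ * ((1 + 2 * ((P.d + 2) * P.L : ℕ)) * t) := by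
  classical
  set t₁ : ℝ := (1 + 2 * ((P.d + 2) * P.L : ℕ)) * t with ht₁
  have ht₁0 : 0 ≤ t₁ := by positivity
  -- the sign data
  set K : BondIdx D → ℝ := fun i => H₀ (Pi.single i 1) b with hK
  set Xr : BondIdx D → ℝ := fun i => if 0 ≤ K i then (((P.L : ℝ) ^ (i.1.1 : ℕ) * η)⁻¹) * t₁ else -((((P.L : ℝ) ^ (i.1.1 : ℕ) * η)⁻¹) * t₁)
    with hXr
  have hwpos : ∀ i : BondIdx D, 0 < (P.L : ℝ) ^ (i.1.1 : ℕ) * η := fun i => by have := P.L_pos; positivity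
  have hXr_abs : ∀ i, ((P.L : ℝ) ^ (i.1.1 : ℕ) * η) * |Xr i| ≤ t₁ := by
    intro i
    have habs : |Xr i| = (((P.L : ℝ) ^ (i.1.1 : ℕ) * η)⁻¹) * t₁ := by
      simp only [hXr]
      split_ifs
      · exact abs_of_nonneg (by positivity)
      · rw [abs_neg]; exact abs_of_nonneg (by positivity)
    rw [habs, ← mul_assoc, mul_inv_cancel₀ (hwpos i).ne', one_mul]
  have hKX : ∀ i, K i * Xr i = |K i| * ((((P.L : ℝ) ^ (i.1.1 : ℕ) * η)⁻¹) * t₁) := by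
    intro i
    simp only [hXr]
    split_ifs with h
    · rw [abs_of_nonneg h]
    · rw [abs_of_neg (not_le.mp h)]; ring
  -- `H₀ Xr b = Σ_i K_i Xr_i`
  have hH₀ : H₀ Xr b = ∑ i, K i * Xr i := by
    have hdec : Xr = ∑ i, Xr i • (Pi.single i (1 : ℝ) : BondIdx D → ℝ) := by
      funext i'
      simp only [Finset.sum_apply, Pi.smul_apply, Pi.single_apply, smul_eq_mul, mul_ite, mul_one, mul_zero]
      rw [Finset.sum_ite_eq]; simp
    conv_lhs => rw [hdec]
    rw [map_sum, Finset.sum_apply]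
    refine Finset.sum_congr rfl fun i _ => ?_
    rw [map_smul, Pi.smul_apply, smul_eq_mul, mul_comm]
  -- the chain
  have h1 : ‖Y X b‖ ≤ ∑ i, |K i| * ((((P.L : ℝ) ^ (i.1.1 : ℕ) * η)⁻¹) * t₁) := by
    rw [hY]
    refine (norm_sum_le _ _).trans (Finset.sum_le_sum fun i _ => ?_)
    rw [norm_smul, Real.norm_eq_abs]
    exact mul_le_mul_of_nonneg_left (norm_Xt_le D η Xf hXf κ hκ0 hκs Xt hXt hη X ht hX i) (abs_nonneg _)
  have hw0 : 0 ≤ w₁ b := by rw [hw₁]; have := P.L_pos; positivity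
  calc w₁ b * ‖Y X b‖ ≤ w₁ b * ∑ i, |K i| * ((((P.L : ℝ) ^ (i.1.1 : ℕ) * η)⁻¹) * t₁) := mul_le_mul_of_nonneg_left h1 hw0
    _ = w₁ b * H₀ Xr b := by rw [hH₀]; simp_rw [hKX]
    _ ≤ w₁ b * |H₀ Xr b| := mul_le_mul_of_nonneg_left (le_abs_self _) hw0
    _ ≤ B₀ * t₁ := hsup Xr t₁ ht₁0 hXr_abs b

/-- The site index (pin) of the territory of a fine site. [cite: Balaban1984PropagatorsII, (2.4) p.224] -/
theorem pin_mem (x : Site P 0) : levOf (fun i => {z : Site P 0 | D.InOm i z}) D.k x < D.k + 1 :=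
  Nat.lt_succ_of_le (FlatCubeLevels.levOf_inOm_le D x)

include hτ0 in
/-- **SUPPORT OF THE TENTS**: `τ_s(x) ≠ 0` only for the site index `s` of the territory of `x`. [cite: Balaban1984PropagatorsII, (2.4) p.224] -/
theorem tau_eq_zero_of_ne (x : Site P 0) (s : SiteIdx D)
    (hs : s ≠ ⟨⟨⟨levOf (fun i => {z : Site P 0 | D.InOm i z}) D.k x, pin_mem D x⟩,
      iterBlockOf (levOf (fun i => {z : Site P 0 | D.InOm i z}) D.k x) x⟩, FlatCubeLevels.lamSite_levOf_inOm D x⟩) : τ s x = 0 := by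
  refine hτ0 s x fun heq => hs ?_
  have hlev : levOf (fun i => {z : Site P 0 | D.InOm i z}) D.k x = (s.1.1 : ℕ) :=
    FlatCubeLevels.levOf_inOm_unique D (by rw [heq]; exact s.2)
  obtain ⟨⟨j, y⟩, h⟩ := s
  simp only at heq hlev ⊢
  have hjF : j = ⟨levOf (fun i => {z : Site P 0 | D.InOm i z}) D.k x, pin_mem D x⟩ := Fin.ext hlev.symm
  subst hjF
  subst heq
  rfl

include hΛ0 hΛs hXf hκ0 hκs hXt hY hw₁ hsup in
/-- **LOCAL SIZE OF THE PINNED VALUES**: at a site index `(j, y)`, `‖Λ_j(Y)(y)‖ ≤ (d+2)L·L^j·B₀(1+2(d+2)L)t/(L^jη)` (inside `B^j(y)` every fine bond has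
territory `j`, where `Y`'s letter reads `‖Y‖ ≤ B₀t₁/(L^jη)`). [cite: Balaban1985Variational, (46) p.285; Balaban1985Averaging, (62) p.28] -/
theorem norm_Lam_pin_le (hη : 0 < η) (hB₀ : 0 ≤ B₀) (X : BondIdx D → Matrix n n ℂ) {t : ℝ} (ht : 0 ≤ t) (hX : ∀ i, ‖X i‖ ≤ t) (s : SiteIdx D) :
    ‖Λ (s.1.1 : ℕ) (Y X) s.1.2‖ ≤
      ((P.d + 2) * P.L : ℕ) * (P.L : ℝ) ^ (s.1.1 : ℕ) * (B₀ * ((1 + 2 * ((P.d + 2) * P.L : ℕ)) * t) / ((P.L : ℝ) ^ (s.1.1 : ℕ) * η)) := by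
  have hj : (s.1.1 : ℕ) ≤ P.m + P.K := (D.le_of_lamSite s.2).trans D.hk
  have hwpos : 0 < (P.L : ℝ) ^ (s.1.1 : ℕ) * η := by have := P.L_pos; positivity
  refine norm_combFamily_le Λ hΛ0 hΛs hj (Y X) s.1.2 (by positivity) fun b hbs _ => ?_
  have hlev : levOf (fun i => {z : Site P 0 | D.InOm i z}) D.k b.src = (s.1.1 : ℕ) :=
    FlatCubeLevels.levOf_inOm_unique D (by rw [hbs]; exact s.2)
  have hl := letter_Y D η Xf hXf κ hκ0 hκs Xt hXt H₀ Y hY w₁ hw₁ hsup hη X ht hX b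
  rw [hw₁, hlev] at hl
  rw [le_div_iff₀ hwpos, mul_comm]
  exact hl

include hΛ0 hΛs hXf hκ0 hκs hXt hY hτ0 hφ hw₁ hsup hτlip in
/-- **THE LETTER OF THE GAUGE PART**: `‖φ(b₊) − φ(b₋)‖ ≤ 2(d+2)L·B₀t₁·((L^{j₋}η)⁻¹ + (L^{j₊}η)⁻¹)`, `j_∓` the territories of the end-points (only the two tents
of the end-points' territories move across `b`, each with slope `2/L^j`). [cite: Balaban1985Variational, (46) p.285] -/
theorem norm_dphi_le (hη : 0 < η) (hB₀ : 0 ≤ B₀) (X : BondIdx D → Matrix n n ℂ) {t : ℝ} (ht : 0 ≤ t) (hX : ∀ i, ‖X i‖ ≤ t) (b : PBond P 0) :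
    ‖φ X b.tgt - φ X b.src‖ ≤
      2 * ((P.d + 2) * P.L : ℕ) * (B₀ * ((1 + 2 * ((P.d + 2) * P.L : ℕ)) * t)) *
        ((((P.L : ℝ) ^ levOf (fun i => {z : Site P 0 | D.InOm i z}) D.k b.src * η)⁻¹) +
          (((P.L : ℝ) ^ levOf (fun i => {z : Site P 0 | D.InOm i z}) D.k b.tgt * η)⁻¹)) := by
  classical
  set C : ℝ := (((P.d + 2) * P.L : ℕ) : ℝ) with hC
  set t₁ : ℝ := B₀ * ((1 + 2 * ((P.d + 2) * P.L : ℕ)) * t) with ht₁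
  have ht₁0 : 0 ≤ t₁ := by positivity
  -- the pins of the two end-points
  set p₁ : SiteIdx D := ⟨⟨⟨levOf (fun i => {z : Site P 0 | D.InOm i z}) D.k b.src, pin_mem D b.src⟩,
      iterBlockOf (levOf (fun i => {z : Site P 0 | D.InOm i z}) D.k b.src) b.src⟩, FlatCubeLevels.lamSite_levOf_inOm D b.src⟩ with hp₁
  set p₂ : SiteIdx D := ⟨⟨⟨levOf (fun i => {z : Site P 0 | D.InOm i z}) D.k b.tgt, pin_mem D b.tgt⟩,
      iterBlockOf (levOf (fun i => {z : Site P 0 | D.InOm i z}) D.k b.tgt) b.tgt⟩, FlatCubeLevels.lamSite_levOf_inOm D b.tgt⟩ with hp₂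
  -- each term `f s = |τ_s(b₊) − τ_s(b₋)|·‖Λ_s‖`
  set f : SiteIdx D → ℝ := fun s => |τ s b.tgt - τ s b.src| * ‖Λ (s.1.1 : ℕ) (Y X) s.1.2‖ with hf
  have hf0 : ∀ s, 0 ≤ f s := fun s => by positivity
  have hfzero : ∀ s, s ≠ p₁ → s ≠ p₂ → f s = 0 := by
    intro s h1 h2
    simp only [hf]
    rw [tau_eq_zero_of_ne D τ hτ0 b.tgt s h2, tau_eq_zero_of_ne D τ hτ0 b.src s h1, sub_zero, abs_zero, zero_mul]
  have hfle : ∀ s, f s ≤ (if s = p₁ then f p₁ else 0) + (if s = p₂ then f p₂ else 0) := by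
    intro s
    by_cases h1 : s = p₁
    · subst h1; simp only [if_true]; split_ifs <;> linarith [hf0 p₂]
    · by_cases h2 : s = p₂
      · subst h2; simp only [if_true, if_neg h1]; linarith
      · rw [hfzero s h1 h2, if_neg h1, if_neg h2, add_zero]
  -- the bound on one pin term
  have hpin : ∀ (x : Site P 0), f ⟨⟨⟨levOf (fun i => {z : Site P 0 | D.InOm i z}) D.k x, pin_mem D x⟩,
      iterBlockOf (levOf (fun i => {z : Site P 0 | D.InOm i z}) D.k x) x⟩, FlatCubeLevels.lamSite_levOf_inOm D x⟩ ≤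
      2 * C * t₁ * (((P.L : ℝ) ^ levOf (fun i => {z : Site P 0 | D.InOm i z}) D.k x * η)⁻¹) := by
    intro x
    set j := levOf (fun i => {z : Site P 0 | D.InOm i z}) D.k x with hj
    have hLj : 0 < (P.L : ℝ) ^ j := by have := P.L_pos; positivity
    have hwpos : 0 < (P.L : ℝ) ^ j * η := by positivity
    have hΛ := norm_Lam_pin_le D η Λ hΛ0 hΛs Xf hXf κ hκ0 hκs Xt hXt H₀ Y hY w₁ hw₁ hsup hη hB₀ X ht hX
      ⟨⟨⟨j, pin_mem D x⟩, iterBlockOf j x⟩, FlatCubeLevels.lamSite_levOf_inOm D x⟩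
    have hτ := hτlip ⟨⟨⟨j, pin_mem D x⟩, iterBlockOf j x⟩, FlatCubeLevels.lamSite_levOf_inOm D x⟩ b
    simp only at hΛ hτ
    simp only [hf]
    calc |τ _ b.tgt - τ _ b.src| * ‖Λ j (Y X) (iterBlockOf j x)‖
        ≤ (2 / (P.L : ℝ) ^ j) * (C * (P.L : ℝ) ^ j * (t₁ / ((P.L : ℝ) ^ j * η))) :=
          mul_le_mul hτ hΛ (norm_nonneg _) (by positivity)
      _ = 2 * C * t₁ * (((P.L : ℝ) ^ j * η)⁻¹) := by field_simp
  -- assemble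
  have hdiff : φ X b.tgt - φ X b.src = ∑ s : SiteIdx D, (τ s b.tgt - τ s b.src) • Λ (s.1.1 : ℕ) (Y X) s.1.2 := by
    rw [hφ, hφ, ← Finset.sum_sub_distrib]
    refine Finset.sum_congr rfl fun s _ => ?_
    rw [sub_smul]
  rw [hdiff]
  calc ‖∑ s : SiteIdx D, (τ s b.tgt - τ s b.src) • Λ (s.1.1 : ℕ) (Y X) s.1.2‖ ≤ ∑ s, f s := by
        refine (norm_sum_le _ _).trans (Finset.sum_le_sum fun s _ => ?_)
        rw [norm_smul, Real.norm_eq_abs]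
    _ ≤ ∑ s, ((if s = p₁ then f p₁ else 0) + (if s = p₂ then f p₂ else 0)) := Finset.sum_le_sum fun s _ => hfle s
    _ = f p₁ + f p₂ := by rw [Finset.sum_add_distrib, Finset.sum_ite_eq' Finset.univ p₁, Finset.sum_ite_eq' Finset.univ p₂]; simp
    _ ≤ 2 * C * t₁ * (((P.L : ℝ) ^ levOf (fun i => {z : Site P 0 | D.InOm i z}) D.k b.src * η)⁻¹) +
          2 * C * t₁ * (((P.L : ℝ) ^ levOf (fun i => {z : Site P 0 | D.InOm i z}) D.k b.tgt * η)⁻¹) := add_le_add (hpin b.src) (hpin b.tgt)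
    _ = _ := by ring

include hΛ0 hΛs hXf hκ0 hκs hXt hY hτ0 hφ hw₁ hsup hτlip in
/-- **THE WEIGHTED SUP LETTER OF `H X = Y + dφ`**: under (2.2)-admissibility with `R·M ≥ 1` (territory collar),
`w₁(b)·‖HX(b)‖ ≤ B₀(1 + 2C)(1 + 2C + 2CL)·t` for `‖X‖_∞ ≤ t`, `C = (d+2)L` — k-UNIFORM. [cite: Balaban1985Variational, (46) p.285] -/
theorem letter {R M : ℕ} (hAdm : Adm22 D R M) (hRM : 1 ≤ R * M) (hη : 0 < η) (hB₀ : 0 ≤ B₀)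
    (Hf : (BondIdx D → Matrix n n ℂ) → PBond P 0 → Matrix n n ℂ) (hHf : ∀ X b, Hf X b = Y X b + (φ X b.tgt - φ X b.src))
    (X : BondIdx D → Matrix n n ℂ) {t : ℝ} (ht : 0 ≤ t) (hX : ∀ i, ‖X i‖ ≤ t) (b : PBond P 0) :
    w₁ b * ‖Hf X b‖ ≤ B₀ * ((1 + 2 * ((P.d + 2) * P.L : ℕ)) * (1 + 2 * ((P.d + 2) * P.L : ℕ) + 2 * ((P.d + 2) * P.L : ℕ) * P.L)) * t := by
  set C : ℝ := (((P.d + 2) * P.L : ℕ) : ℝ) with hC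
  set t₁ : ℝ := B₀ * ((1 + 2 * ((P.d + 2) * P.L : ℕ)) * t) with ht₁
  have ht₁0 : 0 ≤ t₁ := by positivity
  set j₁ := levOf (fun i => {z : Site P 0 | D.InOm i z}) D.k b.src with hj₁
  set j₂ := levOf (fun i => {z : Site P 0 | D.InOm i z}) D.k b.tgt with hj₂
  have hL1 : (1 : ℝ) ≤ P.L := by exact_mod_cast P.L_pos
  have hL0 : (0 : ℝ) < P.L := by positivity
  have hw : w₁ b = (P.L : ℝ) ^ j₁ * η := hw₁ b
  have hw0 : 0 ≤ w₁ b := by rw [hw]; positivity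
  have hY' := letter_Y D η Xf hXf κ hκ0 hκs Xt hXt H₀ Y hY w₁ hw₁ hsup hη X ht hX b
  have hφ' := norm_dphi_le D η Λ hΛ0 hΛs Xf hXf κ hκ0 hκs Xt hXt H₀ Y hY τ hτ0 φ hφ w₁ hw₁ hsup hτlip hη hB₀ X ht hX b
  -- the collar: `j₁ ≤ j₂ + 1`
  have hlev := (levOf_endpoints_le_succ D hAdm hRM b).1
  have hratio : (P.L : ℝ) ^ j₁ * (((P.L : ℝ) ^ j₂ * η)⁻¹ * η) ≤ P.L := by
    rw [mul_inv, mul_assoc, inv_mul_cancel₀ hη.ne', mul_one, ← div_eq_mul_inv, div_le_iff₀ (by positivity), ← pow_succ']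
    exact pow_le_pow_right₀ hL1 hlev
  have hself : (P.L : ℝ) ^ j₁ * η * (((P.L : ℝ) ^ j₁ * η)⁻¹) = 1 := mul_inv_cancel₀ (by positivity)
  calc w₁ b * ‖Hf X b‖ ≤ w₁ b * (‖Y X b‖ + ‖φ X b.tgt - φ X b.src‖) := by
        rw [hHf]; exact mul_le_mul_of_nonneg_left (norm_add_le _ _) hw0
    _ ≤ t₁ + w₁ b * (2 * C * t₁ * ((((P.L : ℝ) ^ j₁ * η)⁻¹) + (((P.L : ℝ) ^ j₂ * η)⁻¹))) := by
        rw [mul_add]; exact add_le_add hY' (mul_le_mul_of_nonneg_left hφ' hw0)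
    _ = t₁ + 2 * C * t₁ * ((P.L : ℝ) ^ j₁ * η * (((P.L : ℝ) ^ j₁ * η)⁻¹) + (P.L : ℝ) ^ j₁ * (((P.L : ℝ) ^ j₂ * η)⁻¹ * η)) := by
        rw [hw]; ring
    _ ≤ t₁ + 2 * C * t₁ * (1 + P.L) := by
        rw [hself]
        have : 0 ≤ 2 * C * t₁ := by positivity
        nlinarith [hratio]
    _ = _ := by rw [ht₁, hC]; ring

end Letter

end Construction

/-! ## §7 Packaging: the ℂ-linear right inverse with its letter -/

section Package

variable [Fintype n] [DecidableEq n]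

/-- **THE BRIDGE: A RIGHT INVERSE OF THE TRUE LINEARISATION FROM ONE OF THE STRAIGHT AVERAGES, WITH THE WEIGHTED SUP LETTER.**  For a nested family `D`,
(2.2)-admissible with `2L ≤ R·M + 1`, a scale `η > 0`, the level weight `w₁(b) = L^{j(b₋)}η`, and ANY real right inverse `H₀` of the multi-level straight
average on the index bonds obeying the weighted sup letter `w₁(b)|H₀X(b)| ≤ B₀·sup_c L^{j(c)}η|X(c)|` ([Balaban1985Variational] (46) for (157)), there is a
ℂ-linear `H` on matrix data with `η·Q^{(j)}(HX)(c) = X(j,c)` at every index bond — `Q^{(j)}` ANY family with `Q^{(0)} = id`, `Q^{(j+1)} = linAvg∘Q^{(j)}` — and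
`w₁(b)‖HX(b)‖ ≤ B₀(1+2C)(1+2C+2CL)·‖X‖_∞`, `C = (d+2)L`: k-UNIFORM. [cite: Balaban1985Variational, (45)-(46) p.285, (156)-(157) p.302] -/
theorem exists_rightInverse (D : Domains P) {R M : ℕ} (hAdm : Adm22 D R M) (hRM : 2 * P.L ≤ R * M + 1) {η : ℝ} (hη : 0 < η)
    (w₁ : PBond P 0 → ℝ) (hw₁ : ∀ b, w₁ b = (P.L : ℝ) ^ levOf (fun i => {z : Site P 0 | D.InOm i z}) D.k b.src * η)
    (H₀ : (BondIdx D → ℝ) →ₗ[ℝ] (PBond P 0 → ℝ)) (hinv : ∀ (X : BondIdx D → ℝ) (i : BondIdx D), bondAvgIter (i.1.1 : ℕ) (H₀ X) i.1.2 = X i)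
    {B₀ : ℝ} (hB₀ : 0 ≤ B₀)
    (hsup : ∀ (Xr : BondIdx D → ℝ) (t : ℝ), 0 ≤ t → (∀ i, ((P.L : ℝ) ^ (i.1.1 : ℕ) * η) * |Xr i| ≤ t) → ∀ b, w₁ b * |H₀ Xr b| ≤ B₀ * t)
    (Q : (i : ℕ) → (PBond P 0 → Matrix n n ℂ) → PBond P i → Matrix n n ℂ)
    (hQ0 : ∀ Y, Q 0 Y = Y) (hQs : ∀ (i : ℕ) (Y : PBond P 0 → Matrix n n ℂ) (c : PBond P (i + 1)), Q (i + 1) Y c = linAvg (Q i Y) c) :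
    ∃ H : (BondIdx D → Matrix n n ℂ) →ₗ[ℂ] (PBond P 0 → Matrix n n ℂ),
      (∀ (X : BondIdx D → Matrix n n ℂ) (idx : BondIdx D), (η : ℂ) • Q (idx.1.1 : ℕ) (H X) idx.1.2 = X idx) ∧
      ∀ (X : BondIdx D → Matrix n n ℂ) (t : ℝ), 0 ≤ t → (∀ i, ‖X i‖ ≤ t) → ∀ b : PBond P 0,
        w₁ b * ‖H X b‖ ≤ B₀ * ((1 + 2 * ((P.d + 2) * P.L : ℕ)) * (1 + 2 * ((P.d + 2) * P.L : ℕ) + 2 * ((P.d + 2) * P.L : ℕ) * P.L)) * t := by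
  classical
  obtain ⟨Λ, hΛ0, hΛs⟩ := exists_combFamily (P := P) (n := n)
  have htent := fun s : SiteIdx D => exists_tent (P := P) (j := (s.1.1 : ℕ)) ((D.le_of_lamSite s.2).trans D.hk) s.1.2
  choose τ hτ1 hτ0 _hτ01 hτlip using htent
  obtain ⟨Xf, hXf⟩ : ∃ Xf : (BondIdx D → Matrix n n ℂ) → (i : ℕ) → PBond P i → Matrix n n ℂ,
      ∀ X i b, Xf X i b = if h : D.LamBond i b then X ⟨⟨⟨i, Nat.lt_succ_of_le (D.le_of_lamBond h)⟩, b⟩, h⟩ else 0 := ⟨_, fun _ _ _ => rfl⟩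
  obtain ⟨κ, hκ0, hκs⟩ : ∃ κ : (BondIdx D → Matrix n n ℂ) → (j : ℕ) → Site P j → Matrix n n ℂ,
      (∀ X y, κ X 0 y = 0) ∧ ∀ X (i : ℕ) (y : Site P (i + 1)), κ X (i + 1) y = if y ∈ D.Om (i + 1) then 0 else combMean (Xf X i) y :=
    ⟨fun X j => Nat.rec (motive := fun j => Site P j → Matrix n n ℂ) (fun _ => 0)
      (fun i _ y => if y ∈ D.Om (i + 1) then 0 else combMean (Xf X i) y) j, fun _ _ => rfl, fun _ _ _ => rfl⟩
  obtain ⟨Xt, hXt⟩ : ∃ Xt : (BondIdx D → Matrix n n ℂ) → BondIdx D → Matrix n n ℂ,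
      ∀ X idx, Xt X idx = (((P.L : ℝ) ^ (idx.1.1 : ℕ) * η)⁻¹) • (X idx + (κ X idx.1.1 idx.1.2.tgt - κ X idx.1.1 idx.1.2.src)) :=
    ⟨_, fun _ _ => rfl⟩
  obtain ⟨Y, hY⟩ : ∃ Y : (BondIdx D → Matrix n n ℂ) → PBond P 0 → Matrix n n ℂ, ∀ X b, Y X b = ∑ i : BondIdx D, H₀ (Pi.single i 1) b • Xt X i :=
    ⟨_, fun _ _ => rfl⟩
  obtain ⟨φ, hφ⟩ : ∃ φ : (BondIdx D → Matrix n n ℂ) → Site P 0 → Matrix n n ℂ, ∀ X x, φ X x = ∑ s : SiteIdx D, τ s x • Λ (s.1.1 : ℕ) (Y X) s.1.2 :=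
    ⟨_, fun _ _ => rfl⟩
  obtain ⟨Hf, hHf⟩ : ∃ Hf : (BondIdx D → Matrix n n ℂ) → PBond P 0 → Matrix n n ℂ, ∀ X b, Hf X b = Y X b + (φ X b.tgt - φ X b.src) :=
    ⟨_, fun _ _ => rfl⟩
  -- linearity
  have hadd : ∀ X X', Hf (X + X') = Hf X + Hf X' := fun X X' => funext fun b => by
    rw [Pi.add_apply, hHf, hHf, hHf, Y_add D η Xf hXf κ hκ0 hκs Xt hXt H₀ Y hY,
      phi_add D η Λ hΛ0 hΛs Xf hXf κ hκ0 hκs Xt hXt H₀ Y hY τ φ hφ, phi_add D η Λ hΛ0 hΛs Xf hXf κ hκ0 hκs Xt hXt H₀ Y hY τ φ hφ]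
    abel
  have hsmul : ∀ (a : ℂ) X, Hf (a • X) = a • Hf X := fun a X => funext fun b => by
    rw [Pi.smul_apply, hHf, hHf, Y_smul D η Xf hXf κ hκ0 hκs Xt hXt H₀ Y hY,
      phi_smul D η Λ hΛ0 hΛs Xf hXf κ hκ0 hκs Xt hXt H₀ Y hY τ φ hφ, phi_smul D η Λ hΛ0 hΛs Xf hXf κ hκ0 hκs Xt hXt H₀ Y hY τ φ hφ,
      smul_add, smul_sub]
  let H : (BondIdx D → Matrix n n ℂ) →ₗ[ℂ] (PBond P 0 → Matrix n n ℂ) :=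
    { toFun := Hf, map_add' := hadd, map_smul' := hsmul }
  have hRM1 : 1 ≤ R * M := by have := P.hL.2; omega
  refine ⟨H, fun X idx => ?_, fun X t ht hX b => ?_⟩
  · show (η : ℂ) • Q (idx.1.1 : ℕ) (Hf X) idx.1.2 = X idx
    rw [show Hf X = fun b => Y X b + (φ X b.tgt - φ X b.src) from funext (hHf X)]
    exact main_identity D η Q hQ0 hQs Λ hΛ0 hΛs Xf hXf κ hκ0 hκs Xt hXt H₀ hinv Y hY τ hτ1 hτ0 φ hφ hAdm hRM hη.ne' X idx
  · show w₁ b * ‖Hf X b‖ ≤ _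
    exact letter D η Λ hΛ0 hΛs Xf hXf κ hκ0 hκs Xt hXt H₀ Y hY τ hτ0 φ hφ w₁ hw₁ hsup hτlip hAdm hRM1 hη hB₀ Hf hHf X ht hX b

end Package

end Summit.QuantumFields.YangMills.Theorems.ChartHInv

end
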